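import Mathlib.LinearAlgebra.Matrix.NonsingularInverse
import Mathlib.Data.Fin.Tuple.Basic
import Mathlib.Logic.Equiv.Fin.Basic
import Mathlib.Tactic.Module
import HarnessLib

/-!
# The torus translate in the split coordinates: a pure DILATION of the two halves

Topic `NumberTheory/Automorphic`; namespace `Literature.NumberTheory.Automorphic.UnitaryGroup`.  KERNEL mathematics only:
theorems (no `def`, no named fact, no instance, no `sorry`); Mathlib-only imports (companion of
★ `QuadraticHermitianNormSplitForm`, deliberately import-light so that it causes no rebuild of its consumers).

THE MATHEMATICS ([Weil1964] Chap. I n° 13 p. 160: `d₀(α)⁻¹ t₀(f) d₀(α) = t₀(f ∘ α)` — a Levi element acts on the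
Schrödinger model by a change of variables; [Weil1965] Chap. II n° 21–23 pp. 32–36, Chap. VI n° 52 pp. 77–78: at a place
split in the quadratic extension the algebra is of type (II) and everything diagonalises).  In the Darboux coordinates
`u = (u₁, G u₂′)` of the doubled theta carrier the `E`-scalar `V = p₂ + q₂δ` (the `∇`-scalar of a torus translate, ★
`Weil1964/AdelicDoublingGeometricFrameBorel` (L-D): `M_V u = (p₂ u₁ + d q₂ G⁻¹ u₂, q₂ G u₁ + p₂ u₂)`) becomes, in the SPLIT
coordinates `β u = (u₁ + s G⁻¹ u₂, G u₁ - s u₂)` of ★ `QuadraticHermitianNormSplitForm.exists_splitEquiv` (`s² = d`), the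
DIAGONAL dilation by the two «components» `V_w = p₂ + s q₂`, `V_w̄ = p₂ - s q₂` of `V`:
**`β (M_V u) = (V_w • (β u).1, V_w̄ • (β u).2)`** (`split_fst_torusTwist`, `split_snd_torusTwist`; `Fin (n+n)` reading
`split_torusTwist_finSum`; binder form for a split equivalence `β` with its formula `splitEquiv_torusTwist`, and the
`w`-supported case `splitEquiv_torusTwist_of_wbar_eq_one`: `β (M_V x) = (a • (β x).1, (β x).2)`).  Pure algebra over a commutative ring: only `G G⁻¹ = G⁻¹ G = 1` and `s² = d` are used.

USE (cell `hodgecm-mathlib`, FLOOR-0 P4, ENGINE E-2, I-CLOSE (S-1) `hbd_CM`): for a torus element supported on the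
`w`-component (`V_w̄ = 1`) the dilated box `D(1) = 𝒪ⁿ × 𝒪ⁿ` goes to `D(V_w)` — the (L-D-v) clause «the translate dilates the
`x`-half of the `β_v`-coordinates by `s_k = N(t_k)^{∓1}`».  HC_CM is proved only modulo the printed citations until rung 0 closes.

## References
* [Weil1964] A. Weil, *Sur certains groupes d'opérateurs unitaires*, Acta Math. 111 (1964), Chap. I n° 13 p. 160.
* [Weil1965] A. Weil, *Sur la formule de Siegel dans la théorie des groupes classiques*, Acta Math. 113 (1965), Chap. II
  n° 21–23 pp. 32–36, Chap. VI n° 52 pp. 77–78.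
-/

set_option autoImplicit false

namespace Literature.NumberTheory.Automorphic

namespace UnitaryGroup

open Matrix

variable {R : Type*} [CommRing R] {ι : Type*} [Fintype ι] [DecidableEq ι]

/-- **FIRST SPLIT COORDINATE OF THE TORUS TWIST**: `(M_V u)₁ + s G⁻¹ (M_V u)₂ = (p₂ + s q₂) • (u₁ + s G⁻¹ u₂)` for
`M_V u = (p₂ u₁ + d q₂ G⁻¹ u₂, q₂ G u₁ + p₂ u₂)` and `s² = d` — the `x`-half is dilated by `V_w = p₂ + s q₂`.
[cite: Weil1964, Chap. I n° 13 p. 160] -/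
theorem split_fst_torusTwist (G : Matrix ι ι R) (hG : IsUnit G.det) {s d : R} (hs : s * s = d) (p₂ q₂ : R)
    (u₁ u₂ : ι → R) :
    (p₂ • u₁ + (d * q₂) • (G⁻¹ *ᵥ u₂)) + s • G⁻¹ *ᵥ (q₂ • (G *ᵥ u₁) + p₂ • u₂) =
      (p₂ + s * q₂) • (u₁ + s • G⁻¹ *ᵥ u₂) := by
  rw [Matrix.mulVec_add, Matrix.mulVec_smul, Matrix.mulVec_smul, Matrix.mulVec_mulVec, Matrix.nonsing_inv_mul G hG,
    Matrix.one_mulVec, ← hs, smul_add, smul_add, add_smul, add_smul, smul_smul, smul_smul, smul_smul, smul_smul]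
  module

/-- **SECOND SPLIT COORDINATE OF THE TORUS TWIST**: `G (M_V u)₁ - s (M_V u)₂ = (p₂ - s q₂) • (G u₁ - s u₂)` — the
`y`-half is dilated by `V_w̄ = p₂ - s q₂`. [cite: Weil1964, Chap. I n° 13 p. 160] -/
theorem split_snd_torusTwist (G : Matrix ι ι R) (hG : IsUnit G.det) {s d : R} (hs : s * s = d) (p₂ q₂ : R)
    (u₁ u₂ : ι → R) :
    G *ᵥ (p₂ • u₁ + (d * q₂) • (G⁻¹ *ᵥ u₂)) - s • (q₂ • (G *ᵥ u₁) + p₂ • u₂) =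
      (p₂ - s * q₂) • (G *ᵥ u₁ - s • u₂) := by
  rw [Matrix.mulVec_add, Matrix.mulVec_smul, Matrix.mulVec_smul, Matrix.mulVec_mulVec, Matrix.mul_nonsing_inv G hG,
    Matrix.one_mulVec, ← hs, smul_add, smul_sub, sub_smul, sub_smul, smul_smul, smul_smul, smul_smul, smul_smul]
  module

/-- **THE TORUS TWIST IN THE SPLIT COORDINATES, `Fin (n+n)` READING**: for `x ∈ R^{n+n}` and the twisted vector
`y = M_V x` written exactly as in ★ `Weil1964/AdelicDoublingGeometricFrameBorel` (L-D)
(`y = (Sum.elim (p₂ • x¹ + (d q₂) • G⁻¹ x²) (q₂ • G x¹ + p₂ • x²)) ∘ finSumFinEquiv⁻¹`, `x¹ = x ∘ finSumFinEquiv ∘ inl`,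
`x² = x ∘ finSumFinEquiv ∘ inr`), the split coordinates of ★ `ThetaIntegralHermNormSplit.exists_splitBeta_adicCompletion`
(`y ↦ (y¹ + s G⁻¹ y², G y¹ - s y²)` on `Fin.castAdd`∕`Fin.natAdd` halves) are DILATED: `x`-half by `p₂ + s q₂`, `y`-half by
`p₂ - s q₂`. [cite: Weil1965, Chap. II n° 21–23, pp. 32–36; Chap. VI n° 52, pp. 77–78] -/
theorem split_torusTwist_finSum {n : ℕ} (G : Matrix (Fin n) (Fin n) R) (hG : IsUnit G.det) {s d : R} (hs : s * s = d)
    (p₂ q₂ : R) (x : Fin (n + n) → R) :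
    ((fun i => ((Sum.elim (p₂ • ((x ∘ ⇑finSumFinEquiv) ∘ Sum.inl) + (d * q₂) • (G⁻¹ *ᵥ ((x ∘ ⇑finSumFinEquiv) ∘ Sum.inr)))
          (q₂ • (G *ᵥ ((x ∘ ⇑finSumFinEquiv) ∘ Sum.inl)) + p₂ • ((x ∘ ⇑finSumFinEquiv) ∘ Sum.inr))) ∘
            ⇑(finSumFinEquiv (m := n) (n := n)).symm) (Fin.castAdd n i)) +
        s • G⁻¹ *ᵥ (fun i => ((Sum.elim (p₂ • ((x ∘ ⇑finSumFinEquiv) ∘ Sum.inl) +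
            (d * q₂) • (G⁻¹ *ᵥ ((x ∘ ⇑finSumFinEquiv) ∘ Sum.inr)))
          (q₂ • (G *ᵥ ((x ∘ ⇑finSumFinEquiv) ∘ Sum.inl)) + p₂ • ((x ∘ ⇑finSumFinEquiv) ∘ Sum.inr))) ∘
            ⇑(finSumFinEquiv (m := n) (n := n)).symm) (Fin.natAdd n i)) =
      (p₂ + s * q₂) • ((fun i => x (Fin.castAdd n i)) + s • G⁻¹ *ᵥ (fun i => x (Fin.natAdd n i)))) ∧
    (G *ᵥ (fun i => ((Sum.elim (p₂ • ((x ∘ ⇑finSumFinEquiv) ∘ Sum.inl) + (d * q₂) • (G⁻¹ *ᵥ ((x ∘ ⇑finSumFinEquiv) ∘ Sum.inr)))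
          (q₂ • (G *ᵥ ((x ∘ ⇑finSumFinEquiv) ∘ Sum.inl)) + p₂ • ((x ∘ ⇑finSumFinEquiv) ∘ Sum.inr))) ∘
            ⇑(finSumFinEquiv (m := n) (n := n)).symm) (Fin.castAdd n i)) -
        s • (fun i => ((Sum.elim (p₂ • ((x ∘ ⇑finSumFinEquiv) ∘ Sum.inl) +
            (d * q₂) • (G⁻¹ *ᵥ ((x ∘ ⇑finSumFinEquiv) ∘ Sum.inr)))
          (q₂ • (G *ᵥ ((x ∘ ⇑finSumFinEquiv) ∘ Sum.inl)) + p₂ • ((x ∘ ⇑finSumFinEquiv) ∘ Sum.inr))) ∘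
            ⇑(finSumFinEquiv (m := n) (n := n)).symm) (Fin.natAdd n i)) =
      (p₂ - s * q₂) • (G *ᵥ (fun i => x (Fin.castAdd n i)) - s • fun i => x (Fin.natAdd n i))) := by
  have h1 : (x ∘ ⇑finSumFinEquiv) ∘ Sum.inl = fun i => x (Fin.castAdd n i) := by
    funext i; simp only [Function.comp_apply, finSumFinEquiv_apply_left]
  have h2 : (x ∘ ⇑finSumFinEquiv) ∘ Sum.inr = fun i => x (Fin.natAdd n i) := by
    funext i; simp only [Function.comp_apply, finSumFinEquiv_apply_right]
  have hc : ∀ (A B : Fin n → R), (fun i => (Sum.elim A B ∘ ⇑(finSumFinEquiv (m := n) (n := n)).symm) (Fin.castAdd n i)) = A :=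
    fun A B => by funext i; simp only [Function.comp_apply, finSumFinEquiv_symm_apply_castAdd, Sum.elim_inl]
  have hn : ∀ (A B : Fin n → R), (fun i => (Sum.elim A B ∘ ⇑(finSumFinEquiv (m := n) (n := n)).symm) (Fin.natAdd n i)) = B :=
    fun A B => by funext i; simp only [Function.comp_apply, finSumFinEquiv_symm_apply_natAdd, Sum.elim_inr]
  rw [hc, hn, h1, h2]
  exact ⟨split_fst_torusTwist G hG hs p₂ q₂ _ _, split_snd_torusTwist G hG hs p₂ q₂ _ _⟩

/-- **THE TORUS TWIST THROUGH A SPLIT EQUIVALENCE `β`** (binder form, for consumers holding `β` with its defining formula — the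
`(β) (hβ)` shape of ★ `H413E2SWSplitPlaceFrame.exists_vSupported_realising`, `G := gram ⊗ 1`): `β (M_V x) =
((p₂ + s q₂) • (β x).1, (p₂ - s q₂) • (β x).2)` — in the split coordinates the torus translate is the diagonal dilation by
`(V_w, V_w̄)`; for `V_w̄ = 1` it dilates the `x`-half only. [cite: Weil1965, Chap. II n° 21–23, pp. 32–36; Chap. VI n° 52, pp. 77–78] -/
theorem splitEquiv_torusTwist {n : ℕ} (G : Matrix (Fin n) (Fin n) R) (hG : IsUnit G.det) {s d : R} (hs : s * s = d)
    (β : (Fin (n + n) → R) ≃ₗ[R] ((Fin n → R) × (Fin n → R)))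
    (hβ : ∀ y, β y =
      ((fun i => y (Fin.castAdd n i)) + s • G⁻¹ *ᵥ (fun i => y (Fin.natAdd n i)),
        G *ᵥ (fun i => y (Fin.castAdd n i)) - s • (fun i => y (Fin.natAdd n i))))
    (p₂ q₂ : R) (x : Fin (n + n) → R) :
    β ((Sum.elim (p₂ • ((x ∘ ⇑finSumFinEquiv) ∘ Sum.inl) + (d * q₂) • (G⁻¹ *ᵥ ((x ∘ ⇑finSumFinEquiv) ∘ Sum.inr)))
          (q₂ • (G *ᵥ ((x ∘ ⇑finSumFinEquiv) ∘ Sum.inl)) + p₂ • ((x ∘ ⇑finSumFinEquiv) ∘ Sum.inr))) ∘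
        ⇑(finSumFinEquiv (m := n) (n := n)).symm) =
      ((p₂ + s * q₂) • (β x).1, (p₂ - s * q₂) • (β x).2) := by
  rw [hβ, hβ]
  exact Prod.ext (split_torusTwist_finSum G hG hs p₂ q₂ x).1 (split_torusTwist_finSum G hG hs p₂ q₂ x).2

/-- … in particular, for a torus translate supported on the `w`-component with `V_w = p₂ + s q₂ = a` and `V_w̄ = p₂ - s q₂ = 1`
(the shape of the I-CLOSE dilate test: `x`-half dilated by `a`, `y`-half and the prime-to-`v` factor fixed):
`β (M_V x) = (a • (β x).1, (β x).2)`. [cite: Weil1965, Chap. II n° 21–23, pp. 32–36; Chap. VI n° 52, pp. 77–78] -/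
theorem splitEquiv_torusTwist_of_wbar_eq_one {n : ℕ} (G : Matrix (Fin n) (Fin n) R) (hG : IsUnit G.det) {s d : R}
    (hs : s * s = d) (β : (Fin (n + n) → R) ≃ₗ[R] ((Fin n → R) × (Fin n → R)))
    (hβ : ∀ y, β y =
      ((fun i => y (Fin.castAdd n i)) + s • G⁻¹ *ᵥ (fun i => y (Fin.natAdd n i)),
        G *ᵥ (fun i => y (Fin.castAdd n i)) - s • (fun i => y (Fin.natAdd n i))))
    {p₂ q₂ a : R} (hw : p₂ + s * q₂ = a) (hwbar : p₂ - s * q₂ = 1) (x : Fin (n + n) → R) :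
    β ((Sum.elim (p₂ • ((x ∘ ⇑finSumFinEquiv) ∘ Sum.inl) + (d * q₂) • (G⁻¹ *ᵥ ((x ∘ ⇑finSumFinEquiv) ∘ Sum.inr)))
          (q₂ • (G *ᵥ ((x ∘ ⇑finSumFinEquiv) ∘ Sum.inl)) + p₂ • ((x ∘ ⇑finSumFinEquiv) ∘ Sum.inr))) ∘
        ⇑(finSumFinEquiv (m := n) (n := n)).symm) =
      (a • (β x).1, (β x).2) := by
  rw [splitEquiv_torusTwist G hG hs β hβ p₂ q₂ x, hw, hwbar, one_smul]

end UnitaryGroup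

end Literature.NumberTheory.Automorphic
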